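import Summits.Ventures.HodgeRepro2.T5SU11PhaseLaw
import Summits.Ventures.HodgeRepro2.T5SU11CoeffSphericalTransform

/-!
# The Jacobi transform as a Laplace transform in the weight: `m̂_k(λ) = 2π ∫_0^∞ e^{−(k−2)s} Φ_λ(s) ds`

The spherical function is bi-`K`-invariant, hence a function of the Cartan coordinate `t(g) = arsinh|b(g)|`,
hence of the phase `s(g) = log|a(g)|` (`|a|² − |b|² = 1`, so `t = arsinh √(e^{2s} − 1)`): with

  `Φ_λ(s) := φ_λ(a_{t(s)})`,   `t(s) = arsinh √(e^{2s} − 1)`   (`sphPhase`, `sph_eq_sphPhase`),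

the law of the phase (`T5SU11PhaseLaw`) turns the Jacobi transform into a Laplace transform in the weight:

  **`∫_G (1 − |g·0|²)^{k/2} φ_λ(g) dν = 2π ∫_0^∞ e^{−(k−2)s} Φ_λ(s) ds`**   (`jacobi_eq_laplace_phase`)

for `k > 1`, `λ < k`, `k + λ > 2` — every value of the chapter is the Laplace transform of the positive,
continuous function `Φ_λ` at `k − 2`; the lowest-weight coefficient transform of the weight `k` is
`(π/(k−1))` times it (`coeff_transform_eq_laplace_phase`); `Φ_λ(0) = 1`, `Φ_0 ≡ 1`, `Φ_λ = Φ_{2−λ}`, `Φ_λ > 0`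
(`sphPhase_zero`, `sphPhase_lam_zero`, `sphPhase_two_sub`, `sphPhase_pos`). Nothing is claimed about (N).

Blind lane: Mathlib + the HodgeRepro2 prefix only; no sorry; axioms ⊆ {propext, Classical.choice,
Quot.sound}.
-/

namespace Summit.Ventures.HodgeRepro2.T5SU11JacobiLaplacePhase

open MeasureTheory MeasureTheory.Measure Metric Set Filter Topology
open T5SU11Unimodular T5SU11Fibration T5SU11Cartan T5SU11OneParameter T5SU11CartanProjection T5HaarCircle
  T5BergmanCoefficient T5BergmanActStable T5SU11FibrationHaar T5SU11SphericalFunction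
  T5SU11SphericalSymmetry T5SU11SphericalBounds T5SU11SphericalContinuous T5SU11JacobiIwasawa
  T5SU11JacobiTransform T5SU11JacobiWeight T5SU11PhaseLaw T5BergmanPairing T5BergmanMatrixCoeff
  T5BergmanIntegrableSharp T5SU11CoeffSphericalTransform
open scoped Real

/-! ### The Cartan coordinate as a function of the phase -/

/-- `t(s) = arsinh √(e^{2s} − 1)`: the Cartan coordinate with `cosh t = e^s`. -/
noncomputable def cartanOfPhase (s : ℝ) : ℝ := Real.arsinh (Real.sqrt (Real.exp (2 * s) - 1))

/-- `t(log|a(g)|) = t(g)` (`|a|² − |b|² = 1`). -/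
lemma cartanOfPhase_log (g : SU11) : cartanOfPhase (Real.log ‖mat g 0 0‖) = cartanT g := by
  unfold cartanOfPhase cartanT
  congr 1
  have ha : 0 < ‖mat g 0 0‖ := norm_mat_pos g
  have h := norm_sq_sub_norm_sq g
  rw [show 2 * Real.log ‖mat g 0 0‖ = Real.log (‖mat g 0 0‖ ^ 2) by rw [Real.log_pow]; push_cast; ring,
    Real.exp_log (by positivity), show ‖mat g 0 0‖ ^ 2 - 1 = ‖mat g 0 1‖ ^ 2 by linarith,
    Real.sqrt_sq (norm_nonneg _)]

/-- `t(s)` is continuous. -/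
lemma continuous_cartanOfPhase : Continuous cartanOfPhase :=
  Real.continuous_arsinh.comp (Real.continuous_sqrt.comp
    ((Real.continuous_exp.comp (continuous_const.mul continuous_id)).sub continuous_const))

/-! ### The spherical function in the phase variable -/

section measure

variable [MeasurableSpace Circle] [BorelSpace Circle]

/-- **The spherical function in the phase variable**: `Φ_λ(s) = φ_λ(a_{t(s)})`. -/
noncomputable def sphPhase (lam s : ℝ) : ℝ := sph lam (hyp (cartanOfPhase s))

/-- `φ_λ(g) = Φ_λ(log|a(g)|)`. -/
theorem sph_eq_sphPhase (lam : ℝ) (g : SU11) : sph lam g = sphPhase lam (Real.log ‖mat g 0 0‖) := by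
  rw [sphPhase, cartanOfPhase_log, ← sph_eq_sph_hyp_cartanT]

/-- `Φ_λ` is continuous. -/
theorem continuous_sphPhase (lam : ℝ) : Continuous (sphPhase lam) :=
  (continuous_sph_hyp lam).comp continuous_cartanOfPhase

/-- `Φ_λ > 0`. -/
theorem sphPhase_pos (lam s : ℝ) : 0 < sphPhase lam s := sph_hyp_pos lam _

/-- `Φ_λ(0) = 1`. -/
theorem sphPhase_zero (lam : ℝ) : sphPhase lam 0 = 1 := by
  rw [sphPhase, cartanOfPhase]
  simp only [mul_zero, Real.exp_zero, sub_self, Real.sqrt_zero, Real.arsinh_zero,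
    hyp_zero, sph_one]

/-- `Φ_0 ≡ 1`. -/
theorem sphPhase_lam_zero (s : ℝ) : sphPhase 0 s = 1 := by
  rw [sphPhase, sph_zero]

/-- `Φ_λ = Φ_{2−λ}`. -/
theorem sphPhase_two_sub (lam s : ℝ) : sphPhase lam s = sphPhase (2 - lam) s := by
  rw [sphPhase, sphPhase, sph_two_sub]

/-! ### The Laplace form -/

/-- **THE JACOBI TRANSFORM IS A LAPLACE TRANSFORM IN THE WEIGHT**: for `k > 1`, `λ < k`, `k + λ > 2`,
`∫_G (1 − |g·0|²)^{k/2} φ_λ(g) dν = 2π ∫_0^∞ e^{−(k−2)s} Φ_λ(s) ds`. -/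
theorem jacobi_eq_laplace_phase {k lam : ℝ} (hk : 1 < k) (h1 : lam < k) (h2 : 2 < k + lam) :
    ∫ g, (1 - ‖orbit g‖ ^ 2) ^ (k / 2) * sph lam g ∂(nu haarCircle)
      = 2 * π * ∫ s in Ioi (0 : ℝ), Real.exp (-((k - 2) * s)) * sphPhase lam s := by
  have hF : Continuous fun s => Real.exp (-(k * s)) * sphPhase lam s :=
    (Real.continuous_exp.comp (continuous_const.mul continuous_id).neg).mul (continuous_sphPhase lam)
  have hF0 : ∀ s, 0 ≤ s → 0 ≤ Real.exp (-(k * s)) * sphPhase lam s := fun s _ =>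
    mul_nonneg (Real.exp_pos _).le (sphPhase_pos lam s).le
  have e : ∀ g : SU11, (1 - ‖orbit g‖ ^ 2) ^ (k / 2) * sph lam g
      = (fun s => Real.exp (-(k * s)) * sphPhase lam s) (Real.log ‖mat g 0 0‖) := fun g => by
    simp only
    rw [orbit_rpow_eq_exp, sph_eq_sphPhase]
  have hint : Integrable (fun g => (fun s => Real.exp (-(k * s)) * sphPhase lam s)
      (Real.log ‖mat g 0 0‖)) (nu haarCircle) := by
    refine (integrable_orbit_rpow_mul_sph hk h1 h2).congr (Filter.Eventually.of_forall fun g => ?_)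
    exact e g
  rw [integral_congr_ae (Filter.Eventually.of_forall e), integral_phase_eq hF hF0 hint]
  congr 1
  refine setIntegral_congr_fun measurableSet_Ioi fun s _ => ?_
  rw [mul_right_comm, ← Real.exp_add]
  congr 2
  ring

/-- The lowest-weight coefficient transform in Laplace form: for `k ≥ 2`, `λ < k`, `k + λ > 2`,
`∫_G |⟨π_k(g)1,1⟩_k| φ_λ dν = (π/(k−1)) · 2π ∫_0^∞ e^{−(k−2)s} Φ_λ(s) ds`. -/
theorem coeff_transform_eq_laplace_phase (k : ℕ) (hk : 2 ≤ k) {lam : ℝ} (h1 : lam < k)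
    (h2 : 2 < k + lam) :
    ∫ g, ‖matrixCoeff k lowest lowest g‖ * sph lam g ∂(nu haarCircle)
      = π / ((k : ℝ) - 1) * (2 * π * ∫ s in Ioi (0 : ℝ), Real.exp (-(((k : ℝ) - 2) * s)) * sphPhase lam s) := by
  have hk1 : (1 : ℝ) < k := by exact_mod_cast (by omega : 1 < k)
  simp_rw [norm_matrixCoeff_lowest_lowest_eq_orbit_rpow k hk, mul_assoc]
  rw [integral_const_mul, jacobi_eq_laplace_phase hk1 h1 h2]
  ring

/-- The mass in Laplace form: `2π ∫_0^∞ e^{−(k−2)s} ds = 2π/(k − 2)` (`Φ_0 ≡ 1`). -/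
theorem mass_eq_laplace_phase {k : ℝ} (hk : 2 < k) :
    2 * π * ∫ s in Ioi (0 : ℝ), Real.exp (-((k - 2) * s)) * sphPhase 0 s = 2 * π / (k - 2) := by
  simp_rw [sphPhase_lam_zero, mul_one]
  exact phase_law_mass hk

end measure

end Summit.Ventures.HodgeRepro2.T5SU11JacobiLaplacePhase
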